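/-
Origin: expansion seat `planner-pub-hodgecm-toy2-g2-0`, handover 2026-08-18 (`HOME/pub-hodgecm-toy2-g2/lean/Toy2g2/Degree.lean`, md5 671d07d0, 149 lines);
landed by the gen-6 packager in gate run 22 as `HodgeCM/Model/SexticCM/Degree.lean` (import ^import Toy2g2\.→import HodgeCM.Model.SexticCM. ×2).
-/
/-
Copyright: pub-hodgecm formalisation cell (harness21, 2026). New file (not vendored).
Origin: HOME/pub-hodgecm-toy2-g2/lean/Toy2g2/Degree.lean (WIP module `Toy2g2.Degree`; intended final place
`HodgeCM/Model/SexticCM/Degree.lean` = module `HodgeCM.Model.SexticCM.Degree`, CONTRIBUTING §3 L5) (seat planner-pub-hodgecm-toy2-g2-0,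
consistency seat 2 gen 2, part (6a)(ii): PerL's hypotheses are inhabited — [E:Q] in {24, 48}: 6 | d (K <= E), 8 | d (Q(eps) <= E), d <= 48 (signed permutations)).
-/
import Summits.HodgeConjecture.HodgeCM.Model.SexticCM.Closure
import Summits.HodgeConjecture.HodgeCM.Model.SexticCM.Octic

/-!
# The degree of the normal closure: `[E:ℚ] ∈ {24, 48}`

* `6 ∣ [E:ℚ]` from `K ≤ E`;
* `8 ∣ [E:ℚ]` from `ℚ(ε) ≤ E`, `ε = δ₀+δ₁+δ₂`, whose minimal polynomial is the irreducible octic `m_ε`;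
* `[E:ℚ] ≤ 48`: `Gal(E/ℚ)` acts faithfully on `{±δ₀, ±δ₁, ±δ₂}` by signed permutations, giving an injection
  into `Perm(Fin 3) × (Fin 3 → Bool)` (order `48`).
Hence `[E:ℚ] = 24 ∨ [E:ℚ] = 48` (no need to decide which).
-/

open Polynomial IntermediateField NumberField

noncomputable section

namespace HodgeCM.SexticCM

/-! ### `6 ∣ d` -/

/-- (Ported verbatim from the HodgeCMPerL package; no docstring in the source.) -/
lemma six_dvd_finrank_E : 6 ∣ Module.finrank ℚ E := finrank_K ▸ finrank_dvd_of_le_right K_le_E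

/-! ### `8 ∣ d` via `ε = δ₀ + δ₁ + δ₂` -/

/-- `ε = δ₀ + δ₁ + δ₂` -/
def ε : ℂ := δ 0 + δ 1 + δ 2

/-- (Ported verbatim from the HodgeCMPerL package; no docstring in the source.) -/
lemma ε_mem_E : ε ∈ E := add_mem (add_mem (δ_mem_E 0) (δ_mem_E 1)) (δ_mem_E 2)

/-- (Ported verbatim from the HodgeCMPerL package; no docstring in the source.) -/
lemma aeval_ε : aeval ε mε = 0 := by
  have key : ∀ a b c P1 P2 P3 : ℂ, a ^ 2 + b ^ 2 + c ^ 2 = P1 →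
      a ^ 2 * b ^ 2 + b ^ 2 * c ^ 2 + c ^ 2 * a ^ 2 = P2 → a ^ 2 * b ^ 2 * c ^ 2 = P3 →
      (((a + b + c) ^ 2 - P1) ^ 2 - 4 * P2) ^ 2 - 64 * P3 * (a + b + c) ^ 2 = 0 := by
    rintro a b c _ _ _ rfl rfl rfl; ring
  obtain ⟨h1, h2, h3⟩ := vietaC
  have s0 := δ_sq 0; have s1 := δ_sq 1; have s2 := δ_sq 2
  have hP1 : δ 0 ^ 2 + δ 1 ^ 2 + δ 2 ^ 2 = -6 := by
    rw [s0, s1, s2]; linear_combination h1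
  have hP2 : δ 0 ^ 2 * δ 1 ^ 2 + δ 1 ^ 2 * δ 2 ^ 2 + δ 2 ^ 2 * δ 0 ^ 2 = 8 := by
    rw [s0, s1, s2]; linear_combination h2 - 4 * h1
  have hP3 : δ 0 ^ 2 * δ 1 ^ 2 * δ 2 ^ 2 = -1 := by
    rw [s0, s1, s2]; linear_combination h3 - 2 * h2 + 4 * h1
  have h := key (δ 0) (δ 1) (δ 2) _ _ _ hP1 hP2 hP3
  simp only [mε, map_add, map_mul, map_pow, aeval_X, map_ofNat]
  unfold ε
  linear_combination h

/-- (Ported verbatim from the HodgeCMPerL package; no docstring in the source.) -/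
lemma isIntegral_ε : IsIntegral ℚ ε := ⟨mε, mε_monic, by simpa [aeval_def] using aeval_ε⟩

/-- (Ported verbatim from the HodgeCMPerL package; no docstring in the source.) -/
lemma minpoly_ε : minpoly ℚ ε = mε :=
  (minpoly.eq_of_irreducible_of_monic mε_irreducible aeval_ε mε_monic).symm

/-- (Ported verbatim from the HodgeCMPerL package; no docstring in the source.) -/
lemma finrank_Qε : Module.finrank ℚ ℚ⟮ε⟯ = 8 := by
  rw [adjoin.finrank isIntegral_ε, minpoly_ε, mε_natDegree]

/-- (Ported verbatim from the HodgeCMPerL package; no docstring in the source.) -/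
lemma eight_dvd_finrank_E : 8 ∣ Module.finrank ℚ E :=
  finrank_Qε ▸ finrank_dvd_of_le_right (adjoin_simple_le_iff.mpr ε_mem_E)

/-! ### `d ≤ 48` via signed permutations -/

/-- `δ_k` as an element of `E` -/
def δE (k : Fin 3) : E := ⟨δ k, δ_mem_E k⟩

/-- (Ported verbatim from the HodgeCMPerL package; no docstring in the source.) -/
@[simp] lemma coe_δE (k : Fin 3) : ((δE k : E) : ℂ) = δ k := rfl

/-- (Ported verbatim from the HodgeCMPerL package; no docstring in the source.) -/
lemma τ_classify (τ : E ≃ₐ[ℚ] E) (k : Fin 3) :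
    ∃ bm : Bool × Fin 3, ((τ (δE k) : E) : ℂ) = sgn bm.1 * δ bm.2 := by
  have h := emb_root ((algebraMap E ℂ).comp (τ : E →+* E)) (δ_mem_rootSet k) (δ_mem_E k)
  obtain ⟨m, h | h⟩ := (mem_rootSet_iff _).mp h
  · exact ⟨(true, m), by simpa [δE] using h⟩
  · exact ⟨(false, m), by simpa [δE] using h⟩

/-- the sign and the permutation of `τ` -/
def sg (τ : E ≃ₐ[ℚ] E) (k : Fin 3) : Bool := (Classical.choose (τ_classify τ k)).1
/-- (Ported verbatim from the HodgeCMPerL package; no docstring in the source.) -/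
def pm (τ : E ≃ₐ[ℚ] E) (k : Fin 3) : Fin 3 := (Classical.choose (τ_classify τ k)).2

/-- (Ported verbatim from the HodgeCMPerL package; no docstring in the source.) -/
lemma τ_δE (τ : E ≃ₐ[ℚ] E) (k : Fin 3) : ((τ (δE k) : E) : ℂ) = sgn (sg τ k) * δ (pm τ k) :=
  Classical.choose_spec (τ_classify τ k)

/-- (Ported verbatim from the HodgeCMPerL package; no docstring in the source.) -/
lemma pm_injective (τ : E ≃ₐ[ℚ] E) : Function.Injective (pm τ) := by
  intro k k' h
  have e1 := τ_δE τ k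
  have e2 := τ_δE τ k'
  rw [← h] at e2
  -- τ (δE k) = ± τ (δE k')
  have : ((τ (δE k) : E) : ℂ) = (τ (δE k') : E) ∨ ((τ (δE k) : E) : ℂ) = -(τ (δE k') : E) := by
    rw [e1, e2]
    cases sg τ k <;> cases sg τ k' <;> simp
  rcases this with h2 | h2
  · have h3 : τ (δE k) = τ (δE k') := Subtype.ext h2
    have h4 := τ.injective h3
    have : δ k = δ k' := congrArg (fun x : E => (x : ℂ)) h4
    exact δ_injective this
  · have h3 : τ (δE k) = τ (-(δE k')) := by rw [map_neg]; exact Subtype.ext h2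
    have h4 := τ.injective h3
    have : δ k = -δ k' := congrArg (fun x : E => (x : ℂ)) h4
    exact absurd this (δ_ne_neg k k')

/-- (Ported verbatim from the HodgeCMPerL package; no docstring in the source.) -/
lemma pm_bijective (τ : E ≃ₐ[ℚ] E) : Function.Bijective (pm τ) :=
  Finite.injective_iff_bijective.mp (pm_injective τ)

/-- the signed-permutation code of a Galois automorphism -/
def code (τ : E ≃ₐ[ℚ] E) : Equiv.Perm (Fin 3) × (Fin 3 → Bool) :=
  (Equiv.ofBijective _ (pm_bijective τ), sg τ)

/-- (Ported verbatim from the HodgeCMPerL package; no docstring in the source.) -/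
lemma code_injective : Function.Injective code := by
  intro τ τ' h
  have hpm : pm τ = pm τ' := by
    have := congrArg (fun c : Equiv.Perm (Fin 3) × (Fin 3 → Bool) => (c.1 : Fin 3 → Fin 3)) h
    simpa [code] using this
  have hsg : sg τ = sg τ' := congrArg Prod.snd h
  have hδ : ∀ k, τ (δE k) = τ' (δE k) := fun k => by
    apply Subtype.ext; rw [τ_δE, τ_δE, hpm, hsg]
  -- automorphisms agreeing on the `δ_k` agree on the generators `±δ_k` of `E`
  have : (τ : E →+* E).toRatAlgHom = (τ' : E →+* E).toRatAlgHom := by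
    apply adjoin_algHom_ext ℚ
    intro r hr
    change τ ⟨r, _⟩ = τ' ⟨r, _⟩
    obtain ⟨k, hk | hk⟩ := (mem_rootSet_iff r).mp hr
    · have e : (⟨r, subset_adjoin ℚ _ hr⟩ : E) = δE k := Subtype.ext hk
      rw [e, hδ k]
    · have e : (⟨r, subset_adjoin ℚ _ hr⟩ : E) = -δE k := Subtype.ext hk
      rw [e, map_neg, map_neg, hδ k]
  exact AlgEquiv.ext fun x => congrArg (fun f : E →ₐ[ℚ] E => f x) this

/-- (Ported verbatim from the HodgeCMPerL package; no docstring in the source.) -/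
lemma card_code_target : Nat.card (Equiv.Perm (Fin 3) × (Fin 3 → Bool)) = 48 := by
  rw [Nat.card_prod, Nat.card_perm, Nat.card_fun]; simp; decide

/-- (Ported verbatim from the HodgeCMPerL package; no docstring in the source.) -/
lemma finrank_E_le : Module.finrank ℚ E ≤ 48 := by
  rw [← IsGalois.card_aut_eq_finrank, ← card_code_target]
  exact Nat.card_le_card_of_injective code code_injective

/-! ### Conclusion -/

/-- (Ported verbatim from the HodgeCMPerL package; no docstring in the source.) -/
theorem finrank_E : Module.finrank ℚ E = 24 ∨ Module.finrank ℚ E = 48 := by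
  have h6 := six_dvd_finrank_E
  have h8 := eight_dvd_finrank_E
  have hle := finrank_E_le
  have hpos : 0 < Module.finrank ℚ E := Module.finrank_pos
  omega

end HodgeCM.SexticCM
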